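import Summits.AtomisticToContinuum.HydrodynamicLimit.Theorems.CollisionIsometryCLTAdaptedWeightCLTBHFewCollisionsEqRung

/-!
# Equilibrium rung of the EXPONENTIALLY velocity-weighted collision count (variant of S0 `stub_fewCollisions`,
# line `block-h-dissipation-closure`, crux `AdaptedWeightCLT`, stmt-AtomisticToContinuum-14868)

Support file (`--supports stmt-AtomisticToContinuum-14868`, helper anchor `bhFewCollisions_expRung_anchor`) of the stub
worker of `stub_fewCollisions`. The line lead considers re-typing S0 with the exponentially velocity-weighted count
`Σ_{collisions in (0,t], i<j} e^{λ'(‖vᵢ‖² + ‖vⱼ‖²)}` in place of the energy-weighted `collCount` (the per-contact remainders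
of S1/S2 at LONELY contacts are priced by such weights). This file shows that the equilibrium rung of
`…BHFewCollisionsEqRung` covers that form verbatim: for every measurable nonnegative velocity mark `g` the marked count
`Φ.collisionPairSum (Ioc 0 t) (fun _ w i j => if i < j then g (vᵢ, vⱼ) else 0)` is dominated on good orbits by the tree's
inline collision mark sum of `g` over `[0, t]` (`ofReal_markedCount_le_markSum`) and is a.e.-measurable for every local
Gibbs law (`aemeasurable_ofReal_markedCount`, Alexander's dictionary `aemeasurable_collisionPairSum`); for the exponential
mark `g = e^{λ'(‖v‖² + ‖w‖²)}` the Gaussian flux integral `∫ ‖w − v‖ g dN(u,θ)^{⊗2}` is finite for SOME `λ' > 0`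
(`exists_lintegral_fluxMark_exp_ne_top`, Fernique's theorem `IsGaussian.exists_integrable_exp_sq` for `N(u, θ)`; any
`λ' < 1/(4θ)` would do), so the generic rung `tendsto_measure_gt_rpow_of_markSum` gives (`fewExpCollisions_const`): at
constant profiles, for every `0 < σ < 1/2`, every flow family and `t > 0`,
`∃ λ' > 0 ∀ p > 0, P_N{(N+1)^{4/3+p} < Σ_{coll, i<j} e^{λ'(‖vᵢ‖²+‖vⱼ‖²)}} → 0`. No definitions are introduced.
-/

namespace Summit.AtomisticToContinuum.HydrodynamicLimit.Theorems.BlockHDissipation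

open scoped BigOperators Topology Classical MeasureTheory ENNReal InnerProductSpace
open Filter Set MeasureTheory ProbabilityTheory
open Literature.Analysis.FluidPDE
open Summit.AtomisticToContinuum.HydrodynamicLimit.Theorems.ContactSourceDuhamel (T3 V3 Cfg Vel Flow Flows)
open Summit.AtomisticToContinuum.HydrodynamicLimit.Theorems.ContactSourceDuhamel.TimeLocal
open Literature.MathematicalPhysics.KineticTheory (gaussMeasure hsDiameter hsDiameter_le hsDiameter_pos localGibbsLaw
  localGibbsLaw_absolutelyContinuous ae_mem_good_localGibbsLaw aemeasurable_collisionPairSum)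

noncomputable section

namespace FewCollisions

variable {σ : ℝ} {N : ℕ}

/-! ## Marked collision counts with a general velocity mark `g ≥ 0` -/

/-- The filtered mark is nonnegative. -/
theorem markedMark_nonneg {g : V3 × V3 → ℝ} (hg : ∀ q, 0 ≤ g q) (w : Cfg N) (i j : Fin (N + 1)) :
    (0 : ℝ) ≤ (if i < j then g ((w i).2, (w j).2) else 0) := by
  split_ifs
  · exact hg _
  · exact le_rfl

/-- The filtered mark is at most the mark. -/
theorem markedMark_le {g : V3 × V3 → ℝ} (hg : ∀ q, 0 ≤ g q) (w : Cfg N) (i j : Fin (N + 1)) :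
    (if i < j then g ((w i).2, (w j).2) else 0) ≤ g ((w i).2, (w j).2) := by
  split_ifs
  · exact le_rfl
  · exact hg _

/-- **Domination (real form).** On a good orbit the marked count over `(0, t]` is at most the inline collision mark
sum of `g` over `[0, t]` (all ordered contact pairs). -/
theorem markedCount_le_markSum (Φ : Flow σ N) {z : Cfg N} (hz : z ∈ Φ.good) (t : ℝ) {g : V3 × V3 → ℝ}
    (hg : ∀ q, 0 ≤ g q) :
    Φ.collisionPairSum (Ioc 0 t) (fun _ w i j => if i < j then g ((w i).2, (w j).2) else 0) z ≤
      ∑ᶠ s ∈ collisionTimes (Torus.geometry (Fin 3)) (hsDiameter σ N) (fun r => Φ.flow r z) ∩ Icc 0 t,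
        ∑ i : Fin (N + 1), ∑ j : Fin (N + 1),
          (if i ≠ j ∧ ‖(Torus.geometry (Fin 3)).sepVec (Φ.flow s z i).1 (Φ.flow s z j).1‖ = hsDiameter σ N
            then g ((Φ.flow s z i).2, (Φ.flow s z j).2) else 0) := by
  have hfinC : (collisionTimes (Torus.geometry (Fin 3)) (hsDiameter σ N) (fun r => Φ.flow r z) ∩ Icc 0 t).Finite :=
    Φ.finite_collisionTimes_inter hz Subset.rfl
  unfold HardSphereFlow.collisionPairSum
  calc collisionPairSum (Torus.geometry (Fin 3)) (hsDiameter σ N) (fun r => Φ.flow r z) (Ioc 0 t)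
        (fun s i j => if i < j then g ((Φ.flow s z i).2, (Φ.flow s z j).2) else 0)
      ≤ collisionPairSum (Torus.geometry (Fin 3)) (hsDiameter σ N) (fun r => Φ.flow r z) (Icc 0 t)
          (fun s i j => g ((Φ.flow s z i).2, (Φ.flow s z j).2)) :=
        (collisionPairSum_mono_set Ioc_subset_Icc_self hfinC fun r i j => markedMark_nonneg hg (Φ.flow r z) i j).trans
          (collisionPairSum_mono hfinC fun s _ p _ => markedMark_le hg (Φ.flow s z) p.1 p.2)
    _ = _ := collisionPairSum_eq_finsum_ite (fun r => (Φ.isTrajectory z hz).mem r) (Icc 0 t) _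

/-- `ofReal` of the inline real collision mark sum over `[0, t]` is the inline `ℝ≥0∞` collision mark sum of
`ofReal ∘ g` (good orbit: finitely many collision times). -/
theorem ofReal_markSum_eq (Φ : Flow σ N) {z : Cfg N} (hz : z ∈ Φ.good) (t : ℝ) {g : V3 × V3 → ℝ}
    (hg : ∀ q, 0 ≤ g q) :
    ENNReal.ofReal (∑ᶠ s ∈ collisionTimes (Torus.geometry (Fin 3)) (hsDiameter σ N) (fun r => Φ.flow r z) ∩ Icc 0 t,
        ∑ i : Fin (N + 1), ∑ j : Fin (N + 1),
          (if i ≠ j ∧ ‖(Torus.geometry (Fin 3)).sepVec (Φ.flow s z i).1 (Φ.flow s z j).1‖ = hsDiameter σ N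
            then g ((Φ.flow s z i).2, (Φ.flow s z j).2) else 0)) =
      ∑ᶠ s ∈ collisionTimes (Torus.geometry (Fin 3)) (hsDiameter σ N) (fun r => Φ.flow r z) ∩ Icc 0 t,
        ∑ i : Fin (N + 1), ∑ j : Fin (N + 1),
          (if i ≠ j ∧ ‖(Torus.geometry (Fin 3)).sepVec (Φ.flow s z i).1 (Φ.flow s z j).1‖ = hsDiameter σ N
            then ENNReal.ofReal (g ((Φ.flow s z i).2, (Φ.flow s z j).2)) else 0) := by
  have hfinC : (collisionTimes (Torus.geometry (Fin 3)) (hsDiameter σ N) (fun r => Φ.flow r z) ∩ Icc 0 t).Finite :=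
    Φ.finite_collisionTimes_inter hz Subset.rfl
  have hnn : ∀ (s : ℝ) (i j : Fin (N + 1)), (0 : ℝ) ≤
      (if i ≠ j ∧ ‖(Torus.geometry (Fin 3)).sepVec (Φ.flow s z i).1 (Φ.flow s z j).1‖ = hsDiameter σ N
        then g ((Φ.flow s z i).2, (Φ.flow s z j).2) else 0) := fun s i j => by
    split_ifs
    · exact hg _
    · exact le_rfl
  rw [finsum_mem_eq_finite_toFinset_sum _ hfinC, finsum_mem_eq_finite_toFinset_sum _ hfinC,
    ENNReal.ofReal_sum_of_nonneg fun s _ => Finset.sum_nonneg fun i _ => Finset.sum_nonneg fun j _ => hnn s i j]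
  refine Finset.sum_congr rfl fun s _ => ?_
  rw [ENNReal.ofReal_sum_of_nonneg fun i _ => Finset.sum_nonneg fun j _ => hnn s i j]
  refine Finset.sum_congr rfl fun i _ => ?_
  rw [ENNReal.ofReal_sum_of_nonneg fun j _ => hnn s i j]
  refine Finset.sum_congr rfl fun j _ => ?_
  split_ifs
  · rfl
  · exact ENNReal.ofReal_zero

/-- **Domination (`ℝ≥0∞` form)**, the input `hF` of `tendsto_measure_gt_rpow_of_markSum` for the marked count with
the `ℝ≥0∞` mark `ofReal ∘ g`. -/
theorem ofReal_markedCount_le_markSum (Φ : Flow σ N) {z : Cfg N} (hz : z ∈ Φ.good) (t : ℝ) {g : V3 × V3 → ℝ}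
    (hg : ∀ q, 0 ≤ g q) :
    ENNReal.ofReal (Φ.collisionPairSum (Ioc 0 t) (fun _ w i j => if i < j then g ((w i).2, (w j).2) else 0) z) ≤
      ∑ᶠ s ∈ collisionTimes (Torus.geometry (Fin 3)) (hsDiameter σ N) (fun r => Φ.flow r z) ∩ Icc 0 t,
        ∑ i : Fin (N + 1), ∑ j : Fin (N + 1),
          (if i ≠ j ∧ ‖(Torus.geometry (Fin 3)).sepVec (Φ.flow s z i).1 (Φ.flow s z j).1‖ = hsDiameter σ N
            then ENNReal.ofReal (g ((Φ.flow s z i).2, (Φ.flow s z j).2)) else 0) := by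
  rw [← ofReal_markSum_eq Φ hz t hg]
  exact ENNReal.ofReal_le_ofReal (markedCount_le_markSum Φ hz t hg)

/-- The `ℝ≥0∞` filtered mark `if i < j then ofReal (g (vᵢ, vⱼ)) else 0` is measurable in the configuration. -/
theorem measurable_markedMark_ennreal {g : V3 × V3 → ℝ} (hgm : Measurable g) (i j : Fin (N + 1)) :
    Measurable fun w : Cfg N => (if i < j then ENNReal.ofReal (g ((w i).2, (w j).2)) else 0 : ℝ≥0∞) := by
  by_cases hij : i < j
  · simp only [if_pos hij]
    exact (hgm.comp ((measurable_pi_apply i).snd.prodMk (measurable_pi_apply j).snd)).ennreal_ofReal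
  · simp only [if_neg hij]
    exact measurable_const

/-- On good orbits `ofReal` of the marked count is the `ℝ≥0∞` collision pair sum of the filtered `ℝ≥0∞` mark. -/
theorem ofReal_markedCount_eq (Φ : Flow σ N) {z : Cfg N} (hz : z ∈ Φ.good) (t : ℝ) {g : V3 × V3 → ℝ}
    (hg : ∀ q, 0 ≤ g q) :
    ENNReal.ofReal (Φ.collisionPairSum (Ioc 0 t) (fun _ w i j => if i < j then g ((w i).2, (w j).2) else 0) z) =
      Φ.collisionPairSum (Ioc 0 t)
        (fun _ w i j => (if i < j then ENNReal.ofReal (g ((w i).2, (w j).2)) else 0 : ℝ≥0∞)) z := by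
  have hfin := finite_collisionTimes_Ioc Φ hz t
  unfold HardSphereFlow.collisionPairSum
  rw [collisionPairSum_eq_finset_sum hfin, collisionPairSum_eq_finset_sum hfin,
    ENNReal.ofReal_sum_of_nonneg fun s _ => Finset.sum_nonneg fun p _ => markedMark_nonneg hg (Φ.flow s z) p.1 p.2]
  refine Finset.sum_congr rfl fun s _ => ?_
  rw [ENNReal.ofReal_sum_of_nonneg fun p _ => markedMark_nonneg hg (Φ.flow s z) p.1 p.2]
  refine Finset.sum_congr rfl fun p _ => ?_
  dsimp only
  split_ifs
  · rfl
  · exact ENNReal.ofReal_zero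

/-- **`ofReal` of the marked count is a.e.-measurable for every local Gibbs law** (`0 < σ < 1/2`, `g ≥ 0` measurable),
the input `hFm` of `tendsto_measure_gt_rpow_of_markSum`. -/
theorem aemeasurable_ofReal_markedCount (hσ : 0 < σ) (hσ' : σ < 2⁻¹) (a₀ θ₀ : T3 → ℝ) (u₀ : T3 → V3) (Φ : Flow σ N)
    (t : ℝ) {g : V3 × V3 → ℝ} (hgm : Measurable g) (hg : ∀ q, 0 ≤ g q) :
    AEMeasurable (fun z => ENNReal.ofReal
      (Φ.collisionPairSum (Ioc 0 t) (fun _ w i j => if i < j then g ((w i).2, (w j).2) else 0) z))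
      (localGibbsLaw σ a₀ u₀ θ₀ N Φ) := by
  have hε' : hsDiameter σ N < 1 / 2 := by
    rw [one_div]; exact (hsDiameter_le hσ.le N).trans_lt hσ'
  have hL := aemeasurable_collisionPairSum (hsDiameter_pos hσ N) hε' Φ _ (measurable_markedMark_ennreal hgm) t
  refine (hL.congr ?_).mono_ac (localGibbsLaw_absolutelyContinuous σ a₀ u₀ θ₀ N Φ)
  filter_upwards [Φ.ae_mem_good] with z hz
  exact (ofReal_markedCount_eq Φ hz t hg).symm

/-! ## The exponential mark: Fernique -/

/-- **The Gaussian flux integral of an exponential mark is finite for some rate**: there is `λ' > 0` with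
`∫ ‖w − v‖ e^{λ'(‖v‖² + ‖w‖²)} dN(u,θ)(v) dN(u,θ)(w) < ∞` (Fernique's theorem for the Gaussian `N(u, θ)` gives `C > 0`
with `e^{C‖v‖²}` integrable; `λ' = C/2` and `‖w − v‖ ≤ (1 + ‖v‖)(1 + ‖w‖)`, `(1 + x) e^{λ'x²} ≤ (3/2 + 1/(2λ')) e^{Cx²}`). -/
theorem exists_lintegral_fluxMark_exp_ne_top (u : V3) (θ : ℝ) :
    ∃ lam' : ℝ, 0 < lam' ∧
      ∫⁻ p, ENNReal.ofReal ‖p.2 - p.1‖ * ENNReal.ofReal (Real.exp (lam' * (‖p.1‖ ^ 2 + ‖p.2‖ ^ 2)))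
        ∂((gaussMeasure u θ).prod (gaussMeasure u θ)) ≠ ∞ := by
  set γ := gaussMeasure u θ with hγ
  obtain ⟨C, hC, hint⟩ := IsGaussian.exists_integrable_exp_sq γ
  refine ⟨C / 2, by positivity, ?_⟩
  set K : ℝ := 3 / 2 + 1 / (2 * (C / 2)) with hK
  have hK0 : 0 < K := by positivity
  set F : V3 → ℝ≥0∞ := fun v => ENNReal.ofReal (K * Real.exp (C * ‖v‖ ^ 2)) with hF
  have hFm : Measurable F := by rw [hF]; fun_prop
  -- one factor: `(1 + x) e^{λ' x²} ≤ K e^{C x²}`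
  have hone : ∀ v : V3, (1 + ‖v‖) * Real.exp (C / 2 * ‖v‖ ^ 2) ≤ K * Real.exp (C * ‖v‖ ^ 2) := by
    intro v
    have hx := norm_nonneg v
    have he : 0 < Real.exp (C / 2 * ‖v‖ ^ 2) := Real.exp_pos _
    have h1 : 1 + ‖v‖ ≤ K * (1 + C / 2 * ‖v‖ ^ 2) := by
      rw [hK]
      have h2 : 1 / (2 * (C / 2)) * (C / 2 * ‖v‖ ^ 2) = ‖v‖ ^ 2 / 2 := by field_simp
      nlinarith [sq_nonneg (‖v‖ - 1), h2, mul_nonneg (by positivity : (0 : ℝ) ≤ 3 / 2) (by positivity : 0 ≤ C / 2 * ‖v‖ ^ 2),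
        (by positivity : (0 : ℝ) ≤ 1 / (2 * (C / 2)))]
    have h3 : 1 + C / 2 * ‖v‖ ^ 2 ≤ Real.exp (C / 2 * ‖v‖ ^ 2) := by
      linarith [Real.add_one_le_exp (C / 2 * ‖v‖ ^ 2)]
    have h4 : Real.exp (C * ‖v‖ ^ 2) = Real.exp (C / 2 * ‖v‖ ^ 2) * Real.exp (C / 2 * ‖v‖ ^ 2) := by
      rw [← Real.exp_add]; ring_nf
    rw [h4, ← mul_assoc]
    exact mul_le_mul_of_nonneg_right (h1.trans (mul_le_mul_of_nonneg_left h3 hK0.le)) he.le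
  have hle : ∀ p : V3 × V3, ENNReal.ofReal ‖p.2 - p.1‖ *
      ENNReal.ofReal (Real.exp (C / 2 * (‖p.1‖ ^ 2 + ‖p.2‖ ^ 2))) ≤ F p.1 * F p.2 := by
    intro p
    rw [hF, ← ENNReal.ofReal_mul (norm_nonneg _), ← ENNReal.ofReal_mul (by positivity)]
    refine ENNReal.ofReal_le_ofReal ?_
    have hn : ‖p.2 - p.1‖ ≤ (1 + ‖p.1‖) * (1 + ‖p.2‖) := by
      have := norm_sub_le p.2 p.1
      nlinarith [norm_nonneg p.1, norm_nonneg p.2, mul_nonneg (norm_nonneg p.1) (norm_nonneg p.2)]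
    have hexp : Real.exp (C / 2 * (‖p.1‖ ^ 2 + ‖p.2‖ ^ 2)) =
        Real.exp (C / 2 * ‖p.1‖ ^ 2) * Real.exp (C / 2 * ‖p.2‖ ^ 2) := by
      rw [← Real.exp_add]; ring_nf
    rw [hexp]
    calc ‖p.2 - p.1‖ * (Real.exp (C / 2 * ‖p.1‖ ^ 2) * Real.exp (C / 2 * ‖p.2‖ ^ 2))
        ≤ (1 + ‖p.1‖) * (1 + ‖p.2‖) * (Real.exp (C / 2 * ‖p.1‖ ^ 2) * Real.exp (C / 2 * ‖p.2‖ ^ 2)) :=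
          mul_le_mul_of_nonneg_right hn (by positivity)
      _ = ((1 + ‖p.1‖) * Real.exp (C / 2 * ‖p.1‖ ^ 2)) * ((1 + ‖p.2‖) * Real.exp (C / 2 * ‖p.2‖ ^ 2)) := by ring
      _ ≤ (K * Real.exp (C * ‖p.1‖ ^ 2)) * (K * Real.exp (C * ‖p.2‖ ^ 2)) :=
          mul_le_mul (hone p.1) (hone p.2) (by positivity) (by positivity)
  have hFint : ∫⁻ v, F v ∂γ ≠ ∞ := (hint.const_mul K).lintegral_lt_top.ne
  refine ne_top_of_le_ne_top (ENNReal.mul_ne_top hFint hFint) ?_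
  calc ∫⁻ p, ENNReal.ofReal ‖p.2 - p.1‖ * ENNReal.ofReal (Real.exp (C / 2 * (‖p.1‖ ^ 2 + ‖p.2‖ ^ 2))) ∂(γ.prod γ)
      ≤ ∫⁻ p, F p.1 * F p.2 ∂(γ.prod γ) := lintegral_mono hle
    _ = (∫⁻ v, F v ∂γ) * ∫⁻ v, F v ∂γ := lintegral_prod_mul hFm.aemeasurable hFm.aemeasurable

/-! ## The rungs -/

/-- **THE EQUILIBRIUM RUNG FOR A GENERAL MARKED COUNT.** At constant profiles, for every `0 < σ < 1/2`, every flow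
family, every `t > 0` and every measurable mark `g ≥ 0` with finite Gaussian flux integral: for every `p > 0`,
`P_N{(N+1)^{4/3+p} < Σ_{collisions in (0,t], i<j} g(vᵢ, vⱼ)} → 0` under the homogeneous Gibbs law. -/
theorem markedCount_rung_const {a θ : ℝ} (ha : 0 < a) (hθ : 0 < θ) (u : V3) (hσ : 0 < σ) (hσ' : σ < 2⁻¹)
    (Φ : Flows σ) {t : ℝ} (ht : 0 < t) {g : V3 × V3 → ℝ} (hgm : Measurable g) (hg : ∀ q, 0 ≤ g q)
    (hI : ∫⁻ q, ENNReal.ofReal ‖q.2 - q.1‖ * ENNReal.ofReal (g q) ∂((gaussMeasure u θ).prod (gaussMeasure u θ)) ≠ ∞)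
    {p : ℝ} (hp : 0 < p) :
    Tendsto (fun N : ℕ => localGibbsLaw σ (fun _ => a) (fun _ => u) (fun _ => θ) N (Φ N)
      {z | ((N + 1 : ℕ) : ℝ) ^ ((4 : ℝ) / 3 + p) < (Φ N).collisionPairSum (Ioc 0 t)
        (fun _ w i j => if i < j then g ((w i).2, (w j).2) else 0) z}) atTop (𝓝 0) :=
  tendsto_measure_gt_rpow_of_markSum hσ hσ' ha hθ u Φ ht hgm.ennreal_ofReal hI
    (fun N z => (Φ N).collisionPairSum (Ioc 0 t) (fun _ w i j => if i < j then g ((w i).2, (w j).2) else 0) z)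
    (fun N => aemeasurable_ofReal_markedCount hσ hσ' _ _ _ (Φ N) t hgm hg)
    (fun N _ hz => ofReal_markedCount_le_markSum (Φ N) hz t hg) hp

/-- **FEW EXPONENTIALLY-WEIGHTED COLLISIONS AT EQUILIBRIUM.** At constant profiles `(a, θ, u)`, `0 < a`, `0 < θ`, for
every `0 < σ < 1/2`, every hard-sphere flow family and every horizon `t > 0` there is `λ' > 0` (depending on `u, θ`
only) such that for every `p > 0`,
`P_N{(N+1)^{4/3+p} < Σ_{collisions in (0,t], i<j} e^{λ'(‖vᵢ‖² + ‖vⱼ‖²)}} → 0` under the homogeneous Gibbs law. -/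
theorem fewExpCollisions_const (a θ : ℝ) (u : V3) (ha : 0 < a) (hθ : 0 < θ) {σ : ℝ} (hσ : 0 < σ) (hσ' : σ < 2⁻¹)
    (Φ : Flows σ) {t : ℝ} (ht : 0 < t) :
    ∃ lam' : ℝ, 0 < lam' ∧ ∀ p : ℝ, 0 < p →
      Tendsto (fun N : ℕ => localGibbsLaw σ (fun _ => a) (fun _ => u) (fun _ => θ) N (Φ N)
        {z | ((N + 1 : ℕ) : ℝ) ^ ((4 : ℝ) / 3 + p) < (Φ N).collisionPairSum (Ioc 0 t)
          (fun _ w i j => if i < j then Real.exp (lam' * (‖(w i).2‖ ^ 2 + ‖(w j).2‖ ^ 2)) else 0) z})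
        atTop (𝓝 0) := by
  obtain ⟨lam', hlam', hI⟩ := exists_lintegral_fluxMark_exp_ne_top u θ
  refine ⟨lam', hlam', fun p hp => ?_⟩
  have hgm : Measurable fun q : V3 × V3 => Real.exp (lam' * (‖q.1‖ ^ 2 + ‖q.2‖ ^ 2)) := by fun_prop
  exact markedCount_rung_const ha hθ u hσ hσ' Φ ht hgm (fun q => (Real.exp_pos _).le) hI hp

/-- Registration anchor of this helper file (`--supports stmt-AtomisticToContinuum-14868`, exponential variant of the
equilibrium rung of `stub_fewCollisions`). -/
theorem bhFewCollisions_expRung_anchor : ∀ (a θ : ℝ) (u : V3), 0 < a → 0 < θ → ∀ σ : ℝ, 0 < σ → σ < 2⁻¹ → ∀ (Φ : Flows σ) (t : ℝ), 0 < t → ∃ lam' : ℝ, 0 < lam' ∧ ∀ p : ℝ, 0 < p → Tendsto (fun N : ℕ => localGibbsLaw σ (fun _ => a) (fun _ => u) (fun _ => θ) N (Φ N) {z | ((N + 1 : ℕ) : ℝ) ^ ((4 : ℝ) / 3 + p) < (Φ N).collisionPairSum (Ioc 0 t) (fun _ w i j => if i < j then Real.exp (lam' * (‖(w i).2‖ ^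 2 + ‖(w j).2‖ ^ 2)) else 0) z}) atTop (𝓝 0) :=
  fun a θ u ha hθ _ hσ hσ' Φ _ ht => fewExpCollisions_const a θ u ha hθ hσ hσ' Φ ht

end FewCollisions

end

end Summit.AtomisticToContinuum.HydrodynamicLimit.Theorems.BlockHDissipation
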